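import Literature.NumberTheory.EllipticCurves.HeegnerGeomRelayerProofs
import HarnessLib

/-!
# `[Γ_K ⊇] Gal(K̄/K[c]) : Gal(K̄/K[c'])] = [K[c'] : K[c]]` on the `Γ_K` side, and the torsion-depth step
# `K_k ⊆ K[p] ⇒ K_k ⊆ K[1]` for a split prime `p` (CGLS 2022 §4.1: `d(k) ≥ 2` above the torsion depth)

Topic `NumberTheory/EllipticCurves` (complex multiplication / Heegner points). THEOREMS ONLY (no definition,
no named fact; net Literature debt `0`). Cell `bsd-print-x9`, seat x9-p1 (LEAD; envelope infrastructure part IV-c,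
cruxes stmt-BirchSwinnertonDyer-25235 / -26359). For `c ∣ c'` a transversal of `Gal(K̄/K[c'])` in `Gal(K̄/K[c])`
lifted from `Gal(K[c']/K[c])` has `#Gal(K[c']/K[c])` elements, so the relative index of the tree's
`ringClassSubgroup`s is that cardinal (`relIndex_ringClassSubgroup_eq_natCard`); with Darmon's count
`#Gal(K[p]/K[1]) = p − 1` at a split `p` (`HeegnerTraceSplit.card_ringClassGalOver_eq_of_split`, `d_K < −4`) a
normal subgroup `Λ ⊴ Γ_K` of `p`-power index containing `Gal(K̄/K[p])` contains `Gal(K̄/K[1])`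
(`ringClassSubgroup_one_le_of_ringClassSubgroup_prime_le`) — for `Λ = Gal(K̄/K_k)` this is CGLS's remark that the
shift `d(k)` is `0` or `≥ 2` ("`K_k ⊆ K[p]` forces `K_k ⊆ K[1]` since `[K[p] : K[1]] = p ∓ 1` is prime to `p`",
module docstring of `CastellaGrossiLeeSkinner2022.HowardDivisibilityAnyClassNumber`). HONEST FRAMING: Galois
bookkeeping only. References: [CastellaGrossiLeeSkinner2022] §4.1 (d(k)); [Cox2013] §7.D Cor. 7.28;
[Darmon2004] Prop. 3.10 (proof); [GrossLMS1991] §3.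
-/

set_option autoImplicit false

noncomputable section

open scoped Classical

namespace Literature.NumberTheory.EllipticCurves

open WeierstrassCurve RingClassField

variable {K : Type} [Field K] [NumberField K]

/-- **A transversal of `Gal(K̄/K[c'])` in `Gal(K̄/K[c])` with exactly `#Gal(K[c']/K[c])` elements** (`c ∣ c'`,
`c' ≠ 0`), lifted from `Gal(K[c']/K[c])` (general-conductor twin of
`exists_transversal_ringClassSubgroup_card_eq`). [cite: Cox2013, §7.D Cor. 7.28] [cite: GrossLMS1991, §3] -/
theorem exists_transversal_ringClassSubgroup_card_eq_natCard (hK : IsImaginaryQuadratic K)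
    (jbar : AlgebraicClosure K →+* ℂ) {c c' : ℕ} (hc : c ≠ 0) (hcc' : c ∣ c') (hc' : c' ≠ 0) :
    ∃ S : Finset (Field.absoluteGaloisGroup K), (∀ s ∈ S, s ∈ ringClassSubgroup K c jbar) ∧
      (∀ τ ∈ ringClassSubgroup K c jbar, ∃! s, s ∈ S ∧ s⁻¹ * τ ∈ ringClassSubgroup K c' jbar) ∧
      S.card = Nat.card (ringClassGalOver (jbar.comp (algebraMap K (AlgebraicClosure K))) c' c) := by
  set ι : K →+* ℂ := jbar.comp (algebraMap K (AlgebraicClosure K)) with hι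
  choose τ hτ τC hτC hτg using fun (g : ringClassField K ι c' ≃ₐ[ℚ] ringClassField K ι c')
    (hg : g ∈ ringClassGalOver ι c' c) ↦
      exists_mem_ringClassSubgroup_induces_of_mem_ringClassGalOver hK jbar hcc' hc' hg
  let τ' : (ringClassField K ι c' ≃ₐ[ℚ] ringClassField K ι c') → Field.absoluteGaloisGroup K :=
    fun g ↦ if hg : g ∈ ringClassGalOver ι c' c then τ g hg else 1
  have hτ' : ∀ g (hg : g ∈ ringClassGalOver ι c' c), τ' g = τ g hg := fun g hg ↦ dif_pos hg
  have hdet : ∀ (g : ringClassField K ι c' ≃ₐ[ℚ] ringClassField K ι c')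
      (σ : Field.absoluteGaloisGroup K) (σC : ℂ ≃+* ℂ), (∀ a, σC (jbar a) = jbar (σ • a)) →
      (∀ x : ringClassField K ι c', σC x = ((g x : ringClassField K ι c') : ℂ)) →
      ∀ (g' : ringClassField K ι c' ≃ₐ[ℚ] ringClassField K ι c') (σC' : ℂ ≃+* ℂ),
      (∀ a, σC' (jbar a) = jbar (σ • a)) →
      (∀ x : ringClassField K ι c', σC' x = ((g' x : ringClassField K ι c') : ℂ)) → g = g' := by
    intro g σ σC hσC hg g' σC' hσC' hg'
    apply AlgEquiv.ext; intro x; apply Subtype.ext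
    obtain ⟨a, ha⟩ := mem_range_of_mem_ringClassField hK jbar hc' x.2
    rw [← hg x, ← hg' x, ← ha, hσC, hσC']
  haveI := (finiteDimensional_and_isGalois_ringClassField hK ι hc').1
  haveI : FiniteDimensional ℚ (ringClassField K ι c') := Module.Finite.trans K (ringClassField K ι c')
  have hfin : (ringClassGalOver ι c' c :
      Set (ringClassField K ι c' ≃ₐ[ℚ] ringClassField K ι c')).Finite := Set.toFinite _
  refine ⟨hfin.toFinset.image τ', fun s hs ↦ ?_, fun σ hσ ↦ ?_, ?_⟩
  · obtain ⟨g, hg, rfl⟩ := Finset.mem_image.mp hs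
    have hg' := (hfin.mem_toFinset).mp hg
    rw [hτ' g hg']; exact hτ g hg'
  · obtain ⟨σC, hσC, g, -, hgσ⟩ :=
      exists_ringEquiv_exists_mem_ringClassGal_of_absoluteGaloisGroup hK jbar hc' σ
    have hgOver : g ∈ ringClassGalOver ι c' c := by
      rw [ringClassGalOver, mem_fixingSubgroup_iff]
      rintro y (hy : (y : ℂ) ∈ ringClassField K ι c)
      apply Subtype.ext
      show ((g y : ringClassField K ι c') : ℂ) = y
      rw [hgσ y]
      exact ringEquiv_apply_eq_self_of_mem_ringClassSubgroup hK hc hσ hσC hy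
    have key : ∀ s, s⁻¹ * σ ∈ ringClassSubgroup K c' jbar ↔
        ∃ sC : ℂ ≃+* ℂ, (∀ a, sC (jbar a) = jbar (s • a)) ∧
          ∀ x : ringClassField K ι c', sC x = ((g x : ringClassField K ι c') : ℂ) := by
      intro s
      constructor
      · intro hs
        obtain ⟨sC, hsC⟩ := exists_ringEquiv_apply_eq_smul jbar s
        refine ⟨sC, hsC, fun x ↦ ?_⟩
        obtain ⟨a, ha⟩ := mem_range_of_mem_ringClassField hK jbar hc' x.2
        rw [hgσ x, ← ha, hsC, hσC]
        congr 1
        have h1 : (s⁻¹ * σ) • a = a := smul_eq_self_of_mem_ringClassSubgroup hK jbar hc' hs (by rw [ha]; exact x.2)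
        calc s • a = s • ((s⁻¹ * σ) • a) := by rw [h1]
          _ = σ • a := by rw [← mul_smul, mul_inv_cancel_left]
      · rintro ⟨sC, hsC, hsg⟩
        refine mem_ringClassSubgroup_of_ringEquiv_apply_eq_self (σC := σC.trans sC.symm) ?_ ?_
        · intro a
          rw [RingEquiv.trans_apply, RingEquiv.symm_apply_eq, hσC, hsC, mul_smul, smul_inv_smul]
        · intro u hu
          rw [RingEquiv.trans_apply, RingEquiv.symm_apply_eq]
          have e1 : σC u = ((g ⟨u, hu⟩ : ringClassField K ι c') : ℂ) := (hgσ ⟨u, hu⟩).symm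
          have e2 : sC u = ((g ⟨u, hu⟩ : ringClassField K ι c') : ℂ) := hsg ⟨u, hu⟩
          rw [e1, e2]
    refine ⟨τ' g, ⟨Finset.mem_image.mpr ⟨g, hfin.mem_toFinset.mpr hgOver, rfl⟩, ?_⟩, ?_⟩
    · rw [hτ' g hgOver, key]
      exact ⟨τC g hgOver, hτC g hgOver, hτg g hgOver⟩
    · rintro s ⟨hs, hsσ⟩
      obtain ⟨g', hg', rfl⟩ := Finset.mem_image.mp hs
      have hg'Over := (hfin.mem_toFinset).mp hg'
      obtain ⟨sC, hsC, hsg⟩ := (key _).mp hsσ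
      have hgg' : g' = g := hdet g' (τ' g') (τC g' hg'Over) (by rw [hτ' g' hg'Over]; exact hτC g' hg'Over)
        (hτg g' hg'Over) g sC hsC hsg
      rw [hgg']
  · rw [Finset.card_image_of_injOn, ← Set.ncard_eq_toFinset_card _ hfin, ← Nat.card_coe_set_eq]
    · rfl
    · intro g₁ hg₁ g₂ hg₂ h
      rw [Finset.mem_coe, Set.Finite.mem_toFinset] at hg₁ hg₂
      have h' : τ g₁ hg₁ = τ g₂ hg₂ := by rw [← hτ' g₁ hg₁, ← hτ' g₂ hg₂]; exact h
      exact hdet g₁ (τ g₁ hg₁) (τC g₁ hg₁) (hτC g₁ hg₁) (hτg g₁ hg₁) g₂ (τC g₂ hg₂)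
        (by rw [h']; exact hτC g₂ hg₂) (hτg g₂ hg₂)

/-- **`[Gal(K̄/K[c]) : Gal(K̄/K[c'])] = #Gal(K[c']/K[c])`** for `c ∣ c'` (the tree's `ringClassSubgroup`s).
[cite: Cox2013, §7.D Cor. 7.28 (the degrees [K[c'] : K[c]])] -/
theorem relIndex_ringClassSubgroup_eq_natCard (hK : IsImaginaryQuadratic K) (jbar : AlgebraicClosure K →+* ℂ)
    {c c' : ℕ} (hc : c ≠ 0) (hcc' : c ∣ c') (hc' : c' ≠ 0) :
    (ringClassSubgroup K c' jbar).relIndex (ringClassSubgroup K c jbar) =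
      Nat.card (ringClassGalOver (jbar.comp (algebraMap K (AlgebraicClosure K))) c' c) := by
  obtain ⟨S, hS, htS, hcard⟩ := exists_transversal_ringClassSubgroup_card_eq_natCard hK jbar hc hcc' hc'
  rw [relIndex_eq_card_of_transversal hS htS, hcard]

/-- **No torsion-depth step at conductor `p`** (CGLS 2022 §4.1: `K_k ⊆ K[p]` forces `K_k ⊆ K[1]`): for a prime
`p` with `#Gal(K[p]/K[1]) = p − 1` (the split case with `d_K < −4`: `HeegnerTraceSplit.card_ringClassGalOver_eq_of_split`
at `m = 1`) and a NORMAL subgroup `Λ ⊴ Γ_K` of index a power of `p` (e.g. `Gal(K̄/K_k)`),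
`Gal(K̄/K[p]) ≤ Λ ⇒ Gal(K̄/K[1]) ≤ Λ`, because `[Gal(K̄/K[1]) : Gal(K̄/K[p])] = p − 1` is prime to `p`.
[cite: CastellaGrossiLeeSkinner2022, §4.1 (d(k) ≥ 2 for k > δ) and Rem. 4.1.4] [cite: Cox2013, §7.D Cor. 7.28] -/
theorem ringClassSubgroup_one_le_of_ringClassSubgroup_prime_le (hK : IsImaginaryQuadratic K)
    (jbar : AlgebraicClosure K →+* ℂ) {p : ℕ} (hp : p.Prime)
    (hcardp : Nat.card (ringClassGalOver (jbar.comp (algebraMap K (AlgebraicClosure K))) p 1) = p - 1)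
    {Λ : Subgroup (Field.absoluteGaloisGroup K)} [Λ.Normal] {k : ℕ} (hidx : Λ.index = p ^ k)
    (hle : ringClassSubgroup K p jbar ≤ Λ) : ringClassSubgroup K 1 jbar ≤ Λ := by
  -- `[Gal(K̄/K[1]) : Gal(K̄/K[p])] = p - 1`
  have hrel : (ringClassSubgroup K p jbar).relIndex (ringClassSubgroup K 1 jbar) = p - 1 := by
    rw [relIndex_ringClassSubgroup_eq_natCard hK jbar one_ne_zero (one_dvd p) hp.ne_zero, hcardp]
  -- `Λ.relIndex Gal(K̄/K[1])` divides both `p^k` and `p - 1`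
  have h1 : Λ.relIndex (ringClassSubgroup K 1 jbar) ∣ p ^ k := by
    have := Subgroup.relIndex_dvd_index_of_normal Λ (ringClassSubgroup K 1 jbar)
    rwa [hidx] at this
  have h2 : Λ.relIndex (ringClassSubgroup K 1 jbar) ∣ p - 1 := by
    have := Subgroup.relIndex_dvd_of_le_left (ringClassSubgroup K 1 jbar) hle
    rwa [hrel] at this
  have hcop : Nat.Coprime (p ^ k) (p - 1) :=
    Nat.Coprime.pow_left k ((Nat.coprime_self_sub_right hp.one_le).mpr (Nat.coprime_one_right p))
  have hone : Λ.relIndex (ringClassSubgroup K 1 jbar) = 1 :=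
    Nat.eq_one_of_dvd_coprimes hcop h1 h2
  exact Subgroup.relIndex_eq_one.mp hone

end Literature.NumberTheory.EllipticCurves

end
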